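import Summits.CriticalPhenomena.PercolationContinuityZ3.Theorems.PercNearOneGluingNoHeavyLowerTailGreedyComparatorTools
import HarnessLib

/-!
# `NoHeavyLowerTail` (stmt-CriticalPhenomena-4575) — the GREEDY COMPARATOR CONDITION on champions implies the
# cumulative isolation lemma (all levels), hence the crux

Support file (lemma factory `prim-lf-6`, observer-set technique; `--supports stmt-CriticalPhenomena-4575`).  No definitions,
no named facts, no sorries.

Notation.  `μ_w = prodBernoulli w` on `Fin n`, relays `A`, level `j`, `π(v) = {x ∈ A : v ↔ x}` (`v ∈ π(v)` iff `v ∈ A`),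
`I_w(v) = μ_w{|π(v)| ≤ j}` (the LIGHTNESS of `v`), a CHAMPION of `w` is a relay maximising `I_w` over `A`.  For a finite vertex
set `T` (an "observer set", below always disjoint from `A` except in the Theorem-A branch) write `v ≁ T` for `∀ t ∈ T, v ↮ t`,
`π(T) = {x ∈ A : ∃ t ∈ T, t ↔ x}`, and

  `E₁(T,v) = {v ≁ T, |π(v)| ≤ j}`,  `E₂(T,v) = {v ≁ T, 1 ≤ |π(T)| ≤ j}`,  `E₃(T,a) = {|π(T)| = 0, |π(a)| ≤ j}`,
  `Q(T,v) = {v ~ T, |π(T)| ≤ j}`   (so `μ E₁(T,v) + μ Q(T,v)` is the lightness of `v` in the graph with `T` CONTRACTED),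
  `A_w(T; i, a) = μ_w E₁(T,i) − μ_w E₂(T,i) − μ_w E₃(T,a)`.

`A_w(T;i,a) ≥ 0` for the one-point set `T = {o}` and `i = a` a champion is exactly the cumulative isolation lemma at `o` with the
champion as witness (`μ{1 ≤ N ≤ j} ≤ μ{|π(i)| ≤ j}`, even in the sharper `CST` form `≤ μ{N ≥ 1, |π(i)| ≤ j}`).

**The greedy comparator condition (GCC, hypothesis `hGCC` below; crux evidence `CANDIDATES.md` §C0 of prim-lf-6).**  For every
weighted graph, every `T` disjoint from `A` with a positive-weight BOUNDARY pair `s(y,z)` (`y ∈ T`, `z ∉ T`), and every champion `i`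
of `w`: there are such a boundary pair `e = s(y,z)` and a champion `i₁` of `w[e ↦ 0]` with
`μ_w E₁(T,i₁) + μ_w Q(T,i₁) ≤ μ_w E₁(T,i) + μ_w Q(T,i)` — "some single boundary deletion has a champion that is no lighter than `i`
once `T` is contracted".

**Theorem (`cumulativeIsolation_of_greedyComparator`).**  GCC ⇒ `stub_cumulativeIsolation` (all `n, w, A, o, j`), hence
(`noHeavyLowerTail_of_greedyComparator`) GCC ⇒ `NoHeavyLowerTail`.

Proof (induction on the number of positive-weight pairs not inside `T`, for the statement `A_w(T;i,a) ≥ 0` for all `T` disjoint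
from `A`, champions `i`, relays `a`).  If no boundary pair of `T` has positive weight, then almost surely nothing leaves `T`
(`not_reachable_openGraph_of_closed_cut`), so `μE₂ = 0`, `μE₁ = I(i)`, `μE₃ = I(a) ≤ I(i)`.  Otherwise take `e = s(y,z)`, `i₁` from
GCC, `w₀ = w[e↦0]`.  ONE-BOND STEP (exact identity): by `stub_oneBondDecomp_k15` and `tieLiftOne_real_one_eq`,
`μ_w(S) = (1 − w e) μ_{w₀}(S) + (w e) μ_{w₀}((insert e)⁻¹ S)`, and the preimages of `E₁(T,·), E₂(T,·), E₃(T,·), Q(T,·)` under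
`ω ↦ insert e ω` are `E₁(T ∪ {z},·), …, Q(T ∪ {z},·)` (opening `s(y,z)` is absorbing `z` into the observer set;
`ChampionStability.reachable_insert_iff`).  SWITCH (exact identity): `A(T';i,a) − A(T';i₁,a) = [μE₁(T',i)+μQ(T',i)] − [μE₁(T',i₁)+μQ(T',i₁)]`
because `μE₂(T',v) = μ{1 ≤ |π(T')| ≤ j} − μQ(T',v)` for a relay `v`.  Hence
`A_w(T;i,a) = (1 − w e)·A_{w₀}(T;i₁,a) + (w e)·A_{w₀}(T∪{z};i₁,a) + [comparator] ≥ 0`: the comparator is GCC's, the first term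
is the induction hypothesis (one positive pair fewer), the second is the induction hypothesis if `z ∉ A` and THEOREM A
(`Literature.….observerSet_le_of_lonelier`, van den Berg–Häggström–Kahn) if `z ∈ A` (then `E₃ = ∅` and `z ∈ T ∪ {z}` is a relay no
lighter than the champion `i₁`).  All identities were verified in exact arithmetic on random instances before formalisation
(prim-lf-6 `lab/verify_step.py`); GCC itself has 0 failures in ~4·10⁴ exact instances, an exhaustive `n = 6` census and targeted
adversarial search (census by ttrl2 requested: `lf6-gcc-greedy-comparator`).
-/


noncomputable section

namespace Summit.CriticalPhenomena.PercolationContinuityZ3.Theorems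

open MeasureTheory Set Literature.Probability.LatticeModels Literature.Probability.Percolation
open scoped Classical BigOperators

variable {n : ℕ}

open GreedyComparator ChampionStability

/-! ### The induction -/

/-- **GCC ⟹ `A_w(T;i,a) ≥ 0`** for every `T` disjoint from `A`, every champion `i` and every relay `a`, by induction on the
number of positive-weight pairs not inside `T` (module docstring).  The hypothesis `hGCC` is the greedy comparator condition. -/
theorem A_nonneg_of_greedyComparator
    (hGCC : ∀ (n : ℕ) (w : Sym2 (Fin n) → unitInterval) (A T : Finset (Fin n)) (j : ℕ) (i : Fin n),
      Disjoint T A → i ∈ A →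
      (∀ b ∈ A, (prodBernoulli w).real {ω : BondConfig (Fin n) | (A.filter fun x => ω ∈ openConn b x).card ≤ j} ≤
        (prodBernoulli w).real {ω : BondConfig (Fin n) | (A.filter fun x => ω ∈ openConn i x).card ≤ j}) →
      (∃ y ∈ T, ∃ z : Fin n, z ∉ T ∧ w s(y, z) ≠ 0) →
      ∃ y ∈ T, ∃ z : Fin n, z ∉ T ∧ w s(y, z) ≠ 0 ∧ ∃ i₁ ∈ A,
        (∀ b ∈ A, (prodBernoulli (Function.update w s(y, z) 0)).real {ω : BondConfig (Fin n) | (A.filter fun x => ω ∈ openConn b x).card ≤ j} ≤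
          (prodBernoulli (Function.update w s(y, z) 0)).real {ω : BondConfig (Fin n) | (A.filter fun x => ω ∈ openConn i₁ x).card ≤ j}) ∧
        (prodBernoulli w).real {ω : BondConfig (Fin n) | (∀ t ∈ T, ω ∉ openConn i₁ t) ∧ (A.filter fun x => ω ∈ openConn i₁ x).card ≤ j} +
            (prodBernoulli w).real {ω : BondConfig (Fin n) | (∃ t ∈ T, ω ∈ openConn i₁ t) ∧ (A.filter fun x => ∃ t ∈ T, ω ∈ openConn t x).card ≤ j} ≤
          (prodBernoulli w).real {ω : BondConfig (Fin n) | (∀ t ∈ T, ω ∉ openConn i t) ∧ (A.filter fun x => ω ∈ openConn i x).card ≤ j} +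
            (prodBernoulli w).real {ω : BondConfig (Fin n) | (∃ t ∈ T, ω ∈ openConn i t) ∧ (A.filter fun x => ∃ t ∈ T, ω ∈ openConn t x).card ≤ j}) :
    ∀ (m n : ℕ) (w : Sym2 (Fin n) → unitInterval) (A T : Finset (Fin n)) (j : ℕ) (i a : Fin n),
      (Finset.univ.filter fun f : Sym2 (Fin n) => w f ≠ 0 ∧ ¬ (∀ v ∈ f, v ∈ T)).card ≤ m →
      Disjoint T A → i ∈ A → a ∈ A →
      (∀ b ∈ A, (prodBernoulli w).real {ω : BondConfig (Fin n) | (A.filter fun x => ω ∈ openConn b x).card ≤ j} ≤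
        (prodBernoulli w).real {ω : BondConfig (Fin n) | (A.filter fun x => ω ∈ openConn i x).card ≤ j}) →
      0 ≤ (prodBernoulli w).real {ω : BondConfig (Fin n) | (∀ t ∈ T, ω ∉ openConn i t) ∧ (A.filter fun x => ω ∈ openConn i x).card ≤ j} -
          (prodBernoulli w).real {ω : BondConfig (Fin n) | (∀ t ∈ T, ω ∉ openConn i t) ∧ 1 ≤ (A.filter fun x => ∃ t ∈ T, ω ∈ openConn t x).card ∧ (A.filter fun x => ∃ t ∈ T, ω ∈ openConn t x).card ≤ j} -
          (prodBernoulli w).real {ω : BondConfig (Fin n) | (A.filter fun x => ∃ t ∈ T, ω ∈ openConn t x).card = 0 ∧ (A.filter fun x => ω ∈ openConn a x).card ≤ j} := by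
  intro m
  induction m with
  | zero =>
    intro n w A T j i a hm hTA hi ha hch
    refine base_nonneg w T A hTA hi ha j hch fun y hy z hz => ?_
    by_contra hne
    have hne' : w s(y, z) ≠ 0 := fun h => hne (by rw [h]; rfl)
    have hmem : s(y, z) ∈ (Finset.univ.filter fun f : Sym2 (Fin n) => w f ≠ 0 ∧ ¬ (∀ v ∈ f, v ∈ T)) :=
      Finset.mem_filter.2 ⟨Finset.mem_univ _, hne', fun h => hz (h z (Sym2.mem_mk_right y z))⟩
    have := Finset.card_pos.2 ⟨_, hmem⟩
    omega
  | succ m ih =>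
    intro n w A T j i a hm hTA hi ha hch
    by_cases hb : ∃ y ∈ T, ∃ z : Fin n, z ∉ T ∧ w s(y, z) ≠ 0
    · obtain ⟨y, hy, z, hzT, hyz0, i₁, hi₁, hch₁, hq⟩ := hGCC n w A T j i hTA hi hch hb
      have hyz : y ≠ z := fun h => hzT (h ▸ hy)
      have hp0 : 0 ≤ (w s(y, z) : ℝ) := (w s(y, z)).2.1
      have hp1 : (w s(y, z) : ℝ) ≤ 1 := (w s(y, z)).2.2
      -- the edge count drops
      have hmem : s(y, z) ∈ (Finset.univ.filter fun f : Sym2 (Fin n) => w f ≠ 0 ∧ ¬ (∀ v ∈ f, v ∈ T)) :=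
        Finset.mem_filter.2 ⟨Finset.mem_univ _, hyz0, fun h => hzT (h z (Sym2.mem_mk_right y z))⟩
      have hsub0 : (Finset.univ.filter fun f : Sym2 (Fin n) => Function.update w s(y, z) 0 f ≠ 0 ∧ ¬ (∀ v ∈ f, v ∈ T)) ⊆
          (Finset.univ.filter fun f : Sym2 (Fin n) => w f ≠ 0 ∧ ¬ (∀ v ∈ f, v ∈ T)).erase s(y, z) := by
        intro f hf
        obtain ⟨-, hf1, hf2⟩ := Finset.mem_filter.1 hf
        have hfe : f ≠ s(y, z) := by
          intro h
          rw [h, Function.update_self] at hf1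
          exact hf1 rfl
        rw [Function.update_of_ne hfe] at hf1
        exact Finset.mem_erase.2 ⟨hfe, Finset.mem_filter.2 ⟨Finset.mem_univ _, hf1, hf2⟩⟩
      have hcnt0 : (Finset.univ.filter fun f : Sym2 (Fin n) =>
          Function.update w s(y, z) 0 f ≠ 0 ∧ ¬ (∀ v ∈ f, v ∈ T)).card ≤ m := by
        have := (Finset.card_le_card hsub0).trans (Finset.card_erase_of_mem hmem).le
        omega
      have hcnt1 : (Finset.univ.filter fun f : Sym2 (Fin n) =>
          Function.update w s(y, z) 0 f ≠ 0 ∧ ¬ (∀ v ∈ f, v ∈ insert z T)).card ≤ m := by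
        refine le_trans (Finset.card_le_card fun f hf => ?_) hcnt0
        obtain ⟨-, hf1, hf2⟩ := Finset.mem_filter.1 hf
        exact Finset.mem_filter.2 ⟨Finset.mem_univ _, hf1, fun h => hf2 fun v hv => Finset.mem_insert_of_mem (h v hv)⟩
      -- induction hypotheses
      have IH1 := ih n (Function.update w s(y, z) 0) A T j i₁ a hcnt0 hTA hi₁ ha hch₁
      have IH2 : 0 ≤ (prodBernoulli (Function.update w s(y, z) 0)).real {ω : BondConfig (Fin n) | (∀ t ∈ (insert z T), ω ∉ openConn i₁ t) ∧ (A.filter fun x => ω ∈ openConn i₁ x).card ≤ j} -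
          (prodBernoulli (Function.update w s(y, z) 0)).real {ω : BondConfig (Fin n) | (∀ t ∈ (insert z T), ω ∉ openConn i₁ t) ∧ 1 ≤ (A.filter fun x => ∃ t ∈ (insert z T), ω ∈ openConn t x).card ∧ (A.filter fun x => ∃ t ∈ (insert z T), ω ∈ openConn t x).card ≤ j} -
          (prodBernoulli (Function.update w s(y, z) 0)).real {ω : BondConfig (Fin n) | (A.filter fun x => ∃ t ∈ (insert z T), ω ∈ openConn t x).card = 0 ∧ (A.filter fun x => ω ∈ openConn a x).card ≤ j} := by
        by_cases hzA : z ∈ A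
        · exact relay_branch_nonneg (Function.update w s(y, z) 0) (insert z T) A (Finset.mem_insert_self z T) hzA j hch₁
        · exact ih n (Function.update w s(y, z) 0) A (insert z T) j i₁ a hcnt1
            (Finset.disjoint_insert_left.2 ⟨hzA, hTA⟩) hi₁ ha hch₁
      -- one-bond identities
      have ob1 := real_eq_oneBond_shift w s(y, z) _ _ (preimage_insert_E1 hyz T A hy i j)
      have ob2 := real_eq_oneBond_shift w s(y, z) _ _ (preimage_insert_E2 hyz T A hy i j)
      have ob3 := real_eq_oneBond_shift w s(y, z) _ _ (preimage_insert_E3 hyz T A hy ha j)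
      have ob4 := real_eq_oneBond_shift w s(y, z) _ _ (preimage_insert_E1 hyz T A hy i₁ j)
      have ob5 := real_eq_oneBond_shift w s(y, z) _ _ (preimage_insert_Q hyz T A hy i j)
      have ob6 := real_eq_oneBond_shift w s(y, z) _ _ (preimage_insert_Q hyz T A hy i₁ j)
      -- switch identities
      have sw1 := real_E2_eq (prodBernoulli (Function.update w s(y, z) 0)) T A hi j
      have sw2 := real_E2_eq (prodBernoulli (Function.update w s(y, z) 0)) T A hi₁ j
      have sw3 := real_E2_eq (prodBernoulli (Function.update w s(y, z) 0)) (insert z T) A hi j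
      have sw4 := real_E2_eq (prodBernoulli (Function.update w s(y, z) 0)) (insert z T) A hi₁ j
      rw [ob1, ob2, ob3]
      rw [ob4, ob5, ob6] at hq
      rw [sw1, sw3]
      rw [sw2] at IH1
      rw [sw4] at IH2
      have h1 := mul_nonneg (sub_nonneg.2 hp1) IH1
      have h2 := mul_nonneg hp0 IH2
      nlinarith [h1, h2, hq]
    · push Not at hb
      refine base_nonneg w T A hTA hi ha j hch fun y hy z hz => ?_
      rw [hb y hy z hz]
      rfl

/-- **GCC ⟹ the cumulative isolation lemma** (`stub_cumulativeIsolation` verbatim, all levels): the champion `i` of `w` is a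
valid witness, by `A_nonneg_of_greedyComparator` for the one-point observer set `T = {o}` and `a = i`. -/
theorem cumulativeIsolation_of_greedyComparator
    (hGCC : ∀ (n : ℕ) (w : Sym2 (Fin n) → unitInterval) (A T : Finset (Fin n)) (j : ℕ) (i : Fin n),
      Disjoint T A → i ∈ A →
      (∀ b ∈ A, (prodBernoulli w).real {ω : BondConfig (Fin n) | (A.filter fun x => ω ∈ openConn b x).card ≤ j} ≤
        (prodBernoulli w).real {ω : BondConfig (Fin n) | (A.filter fun x => ω ∈ openConn i x).card ≤ j}) →
      (∃ y ∈ T, ∃ z : Fin n, z ∉ T ∧ w s(y, z) ≠ 0) →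
      ∃ y ∈ T, ∃ z : Fin n, z ∉ T ∧ w s(y, z) ≠ 0 ∧ ∃ i₁ ∈ A,
        (∀ b ∈ A, (prodBernoulli (Function.update w s(y, z) 0)).real {ω : BondConfig (Fin n) | (A.filter fun x => ω ∈ openConn b x).card ≤ j} ≤
          (prodBernoulli (Function.update w s(y, z) 0)).real {ω : BondConfig (Fin n) | (A.filter fun x => ω ∈ openConn i₁ x).card ≤ j}) ∧
        (prodBernoulli w).real {ω : BondConfig (Fin n) | (∀ t ∈ T, ω ∉ openConn i₁ t) ∧ (A.filter fun x => ω ∈ openConn i₁ x).card ≤ j} +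
            (prodBernoulli w).real {ω : BondConfig (Fin n) | (∃ t ∈ T, ω ∈ openConn i₁ t) ∧ (A.filter fun x => ∃ t ∈ T, ω ∈ openConn t x).card ≤ j} ≤
          (prodBernoulli w).real {ω : BondConfig (Fin n) | (∀ t ∈ T, ω ∉ openConn i t) ∧ (A.filter fun x => ω ∈ openConn i x).card ≤ j} +
            (prodBernoulli w).real {ω : BondConfig (Fin n) | (∃ t ∈ T, ω ∈ openConn i t) ∧ (A.filter fun x => ∃ t ∈ T, ω ∈ openConn t x).card ≤ j}) :
    ∀ (n : ℕ) (w : Sym2 (Fin n) → unitInterval) (A : Finset (Fin n)) (o : Fin n) (j : ℕ),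
      A.Nonempty → o ∉ A → ∃ a ∈ A,
        (Literature.Probability.LatticeModels.prodBernoulli w).real
            {ω : Literature.Probability.Percolation.BondConfig (Fin n) |
              1 ≤ (A.filter fun x => ω ∈ Literature.Probability.Percolation.openConn o x).card ∧
                (A.filter fun x => ω ∈ Literature.Probability.Percolation.openConn o x).card ≤ j} ≤
          (Literature.Probability.LatticeModels.prodBernoulli w).real
            {ω : Literature.Probability.Percolation.BondConfig (Fin n) |
              (A.filter fun x => ω ∈ Literature.Probability.Percolation.openConn a x).card ≤ j} := by
  intro n w A o j hA ho
  obtain ⟨i, hi, hch⟩ := MergeStability.exists_champion (prodBernoulli w) A hA j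
  refine ⟨i, hi, ?_⟩
  have hTA : Disjoint ({o} : Finset (Fin n)) A := Finset.disjoint_singleton_left.2 ho
  have key := A_nonneg_of_greedyComparator hGCC _ n w A {o} j i i le_rfl hTA hi hi hch
  set μ := prodBernoulli w with hμ
  have hmeas : ∀ S : Set (BondConfig (Fin n)), MeasurableSet S := fun S => (Set.toFinite S).measurableSet
  have hio : i ≠ o := fun h => ho (h ▸ hi)
  -- `π({o}) = π(o)`
  have hpi : ∀ ω : BondConfig (Fin n), (A.filter fun x => ∃ t ∈ ({o} : Finset (Fin n)), ω ∈ openConn t x) =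
      (A.filter fun x => ω ∈ openConn o x) := by
    intro ω
    apply Finset.filter_congr
    intro x _
    simp only [Finset.mem_singleton, exists_eq_left]
  -- split `L = {1 ≤ N ≤ j}` along `i ↔ o`
  have hsplit : μ.real {ω : BondConfig (Fin n) | 1 ≤ (A.filter fun x => ω ∈ openConn o x).card ∧
      (A.filter fun x => ω ∈ openConn o x).card ≤ j} ≤
      μ.real {ω : BondConfig (Fin n) | (∀ t ∈ ({o} : Finset (Fin n)), ω ∉ openConn i t) ∧
          1 ≤ (A.filter fun x => ∃ t ∈ ({o} : Finset (Fin n)), ω ∈ openConn t x).card ∧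
          (A.filter fun x => ∃ t ∈ ({o} : Finset (Fin n)), ω ∈ openConn t x).card ≤ j} +
        μ.real ({ω : BondConfig (Fin n) | (A.filter fun x => ω ∈ openConn i x).card ≤ j} \
          {ω : BondConfig (Fin n) | (∀ t ∈ ({o} : Finset (Fin n)), ω ∉ openConn i t) ∧
            (A.filter fun x => ω ∈ openConn i x).card ≤ j}) := by
    calc μ.real {ω : BondConfig (Fin n) | 1 ≤ (A.filter fun x => ω ∈ openConn o x).card ∧
          (A.filter fun x => ω ∈ openConn o x).card ≤ j}
        ≤ μ.real ({ω : BondConfig (Fin n) | (∀ t ∈ ({o} : Finset (Fin n)), ω ∉ openConn i t) ∧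
            1 ≤ (A.filter fun x => ∃ t ∈ ({o} : Finset (Fin n)), ω ∈ openConn t x).card ∧
            (A.filter fun x => ∃ t ∈ ({o} : Finset (Fin n)), ω ∈ openConn t x).card ≤ j} ∪
            ({ω : BondConfig (Fin n) | (A.filter fun x => ω ∈ openConn i x).card ≤ j} \
              {ω : BondConfig (Fin n) | (∀ t ∈ ({o} : Finset (Fin n)), ω ∉ openConn i t) ∧
                (A.filter fun x => ω ∈ openConn i x).card ≤ j})) := by
          refine measureReal_mono (fun ω hω => ?_) (measure_ne_top _ _)
          obtain ⟨h1, h2⟩ := hω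
          by_cases hc : ω ∈ openConn i o
          · right
            refine ⟨?_, fun h => h.1 o (Finset.mem_singleton_self o) hc⟩
            have heq : (A.filter fun x => ω ∈ openConn i x) = (A.filter fun x => ω ∈ openConn o x) := by
              apply Finset.filter_congr
              intro x _
              simp only [mem_openConn_iff_reachable] at hc ⊢
              exact ⟨fun h => hc.symm.trans h, fun h => hc.trans h⟩
            show (A.filter fun x => ω ∈ openConn i x).card ≤ j
            rw [heq]; exact h2
          · left
            refine ⟨fun t ht => ?_, ?_, ?_⟩
            · rw [Finset.mem_singleton.1 ht]; exact hc
            · rw [hpi ω]; exact h1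
            · rw [hpi ω]; exact h2
      _ ≤ _ := measureReal_union_le _ _
  have hdiff : μ.real ({ω : BondConfig (Fin n) | (A.filter fun x => ω ∈ openConn i x).card ≤ j} \
          {ω : BondConfig (Fin n) | (∀ t ∈ ({o} : Finset (Fin n)), ω ∉ openConn i t) ∧
            (A.filter fun x => ω ∈ openConn i x).card ≤ j}) =
      μ.real {ω : BondConfig (Fin n) | (A.filter fun x => ω ∈ openConn i x).card ≤ j} -
        μ.real {ω : BondConfig (Fin n) | (∀ t ∈ ({o} : Finset (Fin n)), ω ∉ openConn i t) ∧
            (A.filter fun x => ω ∈ openConn i x).card ≤ j} :=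
    measureReal_sdiff (fun ω hω => hω.2) (hmeas _)
  have hE3 : 0 ≤ μ.real {ω : BondConfig (Fin n) | (A.filter fun x => ∃ t ∈ ({o} : Finset (Fin n)), ω ∈ openConn t x).card = 0 ∧
      (A.filter fun x => ω ∈ openConn i x).card ≤ j} := measureReal_nonneg
  linarith

/-- **GCC closes the crux**: the greedy comparator condition implies `NoHeavyLowerTail`, through
`cumulativeIsolation_of_greedyComparator` and the landed `noHeavyLowerTail_of_stub_cumulativeIsolation`. -/
theorem noHeavyLowerTail_of_greedyComparator
    (hGCC : ∀ (n : ℕ) (w : Sym2 (Fin n) → unitInterval) (A T : Finset (Fin n)) (j : ℕ) (i : Fin n),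
      Disjoint T A → i ∈ A →
      (∀ b ∈ A, (prodBernoulli w).real {ω : BondConfig (Fin n) | (A.filter fun x => ω ∈ openConn b x).card ≤ j} ≤
        (prodBernoulli w).real {ω : BondConfig (Fin n) | (A.filter fun x => ω ∈ openConn i x).card ≤ j}) →
      (∃ y ∈ T, ∃ z : Fin n, z ∉ T ∧ w s(y, z) ≠ 0) →
      ∃ y ∈ T, ∃ z : Fin n, z ∉ T ∧ w s(y, z) ≠ 0 ∧ ∃ i₁ ∈ A,
        (∀ b ∈ A, (prodBernoulli (Function.update w s(y, z) 0)).real {ω : BondConfig (Fin n) | (A.filter fun x => ω ∈ openConn b x).card ≤ j} ≤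
          (prodBernoulli (Function.update w s(y, z) 0)).real {ω : BondConfig (Fin n) | (A.filter fun x => ω ∈ openConn i₁ x).card ≤ j}) ∧
        (prodBernoulli w).real {ω : BondConfig (Fin n) | (∀ t ∈ T, ω ∉ openConn i₁ t) ∧ (A.filter fun x => ω ∈ openConn i₁ x).card ≤ j} +
            (prodBernoulli w).real {ω : BondConfig (Fin n) | (∃ t ∈ T, ω ∈ openConn i₁ t) ∧ (A.filter fun x => ∃ t ∈ T, ω ∈ openConn t x).card ≤ j} ≤
          (prodBernoulli w).real {ω : BondConfig (Fin n) | (∀ t ∈ T, ω ∉ openConn i t) ∧ (A.filter fun x => ω ∈ openConn i x).card ≤ j} +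
            (prodBernoulli w).real {ω : BondConfig (Fin n) | (∃ t ∈ T, ω ∈ openConn i t) ∧ (A.filter fun x => ∃ t ∈ T, ω ∈ openConn t x).card ≤ j}) :
    Summit.CriticalPhenomena.PercolationContinuityZ3.Theses.PercNearOneGluing.NoHeavyLowerTail :=
  noHeavyLowerTail_of_stub_cumulativeIsolation (cumulativeIsolation_of_greedyComparator hGCC)

end Summit.CriticalPhenomena.PercolationContinuityZ3.Theorems

end
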